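import Mathlib
import HarnessLib
import Summits.HubbardSuperconductivity.HubbardSuperconductivity.Theorems.KLProgrammeKLRegimeEngineV8DefsQ5

/-!
# Route `KLProgramme` — ENGINE child (stmt-HubbardSuperconductivity-19918 / gen-6 successor): the leg-dressing `Q.CR` threshold of
# `…SplitLegDressingQ2` (`128·cr + 64·cz ≤ Q.CR·Klam`) HOLDS at the engine packages `klEngQ3 P R` and `klEngQ5 P R` for every well-formed `P`
# (cell gate-hubbard-kl, seat hubbard-kl-k3c2-p3 g3, row «leg-dress bar»; pattern of `deltaUV_absorbed3/5`)

`(klEngQ3 P R).CR = 2^60·Psq²·Rsq²` with `Psq ≥ 1`, `Rsq ≥ max(1, cr)` and `Rsq ≥ cz` (squares), so `128·cr + 64·cz ≤ 192·Rsq ≤ 2^60·Psq²·Rsq² ≤ CR·Klam`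
once `Klam ≥ 1` (`P.WF`); `klEngQ5`'s `CR` is the max of that and `klScaleZeroValC R`.  Discharges the hypothesis `hCR` of
`legDress_size_le_legDressBarQ2` / `klld_legDress_le_legDressBarQ2` at the packages of record.  Proved; no definitions.
-/

noncomputable section

namespace Summit.HubbardSuperconductivity.HubbardSuperconductivity.Theorems.EngineV8

set_option linter.dupNamespace false -- summit = problem name (single-conjunct summit), D-0017

open Real Finset
open Summit.HubbardSuperconductivity.HubbardSuperconductivity.Theorems.KLRegimeSplit

/-- `cz ≤ klEngRsq R`. -/
theorem cz_le_klEngRsq (R : RenConsts) : R.cz ≤ klEngRsq R := by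
  unfold klEngRsq
  have h := sum_nonneg (s := range 5) fun j _ => sq_nonneg (R.Gfr j)
  nlinarith [sq_nonneg (R.cz - 1 / 2), sq_nonneg R.cr]

/-- **The leg-dressing threshold at the v3 package**: `128·cr + 64·cz ≤ (klEngQ3 P R).CR` (no hypothesis). -/
theorem legDress_absorbed3 (P : SplitConsts) (R : RenConsts) : 128 * R.cr + 64 * R.cz ≤ (klEngQ3 P R).CR := by
  show 128 * R.cr + 64 * R.cz ≤ 2 ^ 60 * klEngPsq P ^ 2 * klEngRsq R ^ 2
  have h1 := cr_le_klEngRsq R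
  have h2 := cz_le_klEngRsq R
  have hr := one_le_klEngRsq R
  have hp := one_le_klEngPsq P
  have hp2 : 1 ≤ klEngPsq P ^ 2 := by nlinarith
  have hr2 : klEngRsq R ≤ klEngRsq R ^ 2 := by nlinarith
  nlinarith

/-- **… times `Klam`**: for well-formed `P` (`Klam ≥ 1`), `128·cr + 64·cz ≤ (klEngQ3 P R).CR · P.Klam` — the hypothesis `hCR` of
`legDress_size_le_legDressBarQ2` at `Q := klEngQ3 P R`. -/
theorem legDress_threshold_klEngQ3 {P : SplitConsts} (hP : P.WF) (R : RenConsts) :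
    128 * R.cr + 64 * R.cz ≤ (klEngQ3 P R).CR * P.Klam := by
  have h := legDress_absorbed3 P R
  have hCR : 0 ≤ (klEngQ3 P R).CR := (klEngQ3_wf P R).2.1
  calc 128 * R.cr + 64 * R.cz ≤ (klEngQ3 P R).CR * 1 := by rw [mul_one]; exact h
    _ ≤ (klEngQ3 P R).CR * P.Klam := mul_le_mul_of_nonneg_left hP.1 hCR

/-- **The leg-dressing threshold at the v5 package**: for well-formed `P`, `128·cr + 64·cz ≤ (klEngQ5 P R).CR · P.Klam`. -/
theorem legDress_threshold_klEngQ5 {P : SplitConsts} (hP : P.WF) (R : RenConsts) :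
    128 * R.cr + 64 * R.cz ≤ (klEngQ5 P R).CR * P.Klam := by
  have h := (legDress_absorbed3 P R).trans (klEngQ3_CR_le_klEngQ5_CR P R)
  have hCR : 0 ≤ (klEngQ5 P R).CR := (klEngQ5_wf P R).2.1
  calc 128 * R.cr + 64 * R.cz ≤ (klEngQ5 P R).CR * 1 := by rw [mul_one]; exact h
    _ ≤ (klEngQ5 P R).CR * P.Klam := mul_le_mul_of_nonneg_left hP.1 hCR

end Summit.HubbardSuperconductivity.HubbardSuperconductivity.Theorems.EngineV8

end
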